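import Summits.SmoothPoincare4.SmoothPoincare4.Theorems.DottedCircleRasmussenDcrGapHelperFriendsCarrierVkAdaptedField

/-!
# Helper `helper_friendsCarrier_Vk_adaptedFieldNeat` (piece 7 of the registered helper `helper_friendsCarrier_Vk`,
stub `stub_friendsCarrier`, line `mk_friends`, skeleton v5) for crux `DcrGap`
(item stmt-SmoothPoincare4-16128, route route-SmoothPoincare4-DottedCircleRasmussen)

**The clock field adapted to a NEAT model slice disc** — the form the registered helper
`helper_friendsCarrier_Vk` consumes (its neatness hypothesis `d/dρ G_k(f₁(ρ t))|₁ < 0`), with no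
reparametrisation of the disc.  Companion of `helper_friendsCarrier_Vk_adaptedField` (the same
construction for a level-parametrised disc): for a model slice disc `f₁` of a model knot `K₁` which
leaves `D_k` transversally along `K₁`, there is a `C^∞` compactly supported field `V` on `ℝ⁴` with
`dG_k(V) = 1` on the clock zone `{∀ j, |z - c_j|² > 1/2} ∩ {|G_k - 1| < 3/200}` (input of
`helper_friendsCarrier_Vk_clockFlow`, `ε = 1/200`) and, for `|t - 1| < δ'`, `u ∈ S¹`,

  `V(f₁(t u)) = (d(G_k ∘ f₁)(t u) u)⁻¹ • df₁(t u) u`,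

the tangent vector of the disc ray through `f₁(t u)` normalised to unit clock (the radial derivative
`d(G_k ∘ f₁)(t u) u` is `< 0` near the circle by neatness and continuity).  Hence the flow lines of `V`
from `K₁` sweep out the disc near its boundary (uniqueness of integral curves, as in
`helper_friendsCarrier_Vk_discFlowLines`), parametrised by the level `G_k = 1 + s` instead of the
radius: in the collar of `V` the disc is the product `K₁ × [0, 2ε)`.  Construction as in the level case:
`V = β X/dG_k(X) + (1 - β) W`, `X(F(x, w)) = df₁(x)(x/‖x‖)` in the framed tube `F` of the enlarged disc,
`β` a cutoff in tube coordinates supported where `dG_k(X) < 0`.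

No definitions, no named facts, no `sorry`.

## References

* J. Milnor, *Morse theory* (1963), Thm. 3.1. [Milnor1963]
* M. W. Hirsch, *Differential Topology* (1976), Ch. 4 §5–6. [Hirsch1976]
-/

-- the prescribed namespace `Summit.<P>.<Sub>.…` duplicates `SmoothPoincare4` (P = Sub)
set_option linter.dupNamespace false
set_option linter.style.longLine false

noncomputable section

open scoped Manifold ContDiff Topology
open Set Function Metric Filter
open Literature.Topology.FourManifolds Literature.Topology.FourManifolds.MMSW

namespace Summit.SmoothPoincare4.SmoothPoincare4.Theorems.DcrGap.MkFriends

namespace FriendsCarrierVk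

set_option maxHeartbeats 800000 in
/-- **The unit-clock field tangent to a neat model slice disc.** [cite: Milnor1963, Thm. 3.1] -/
theorem exists_adaptedFieldNeat (k : ℕ) {K₁ : (sphere (0 : EuclideanSpace ℝ (Fin 2)) 1) → EuclideanSpace ℝ (Fin 4)}
    {f₁ : EuclideanSpace ℝ (Fin 2) → EuclideanSpace ℝ (Fin 4)}
    (hK : IsModelKnot k K₁) (hf : IsModelSliceDisc k K₁ f₁)
    (hneat : ∀ t : sphere (0 : EuclideanSpace ℝ (Fin 2)) 1,
      deriv (fun ρ : ℝ => levelFun k (f₁ (ρ • (t : EuclideanSpace ℝ (Fin 2))))) 1 < 0) :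
    ∃ (V : EuclideanSpace ℝ (Fin 4) → EuclideanSpace ℝ (Fin 4)) (R δ' : ℝ), ContDiff ℝ ∞ V ∧ 0 < δ' ∧
      (∀ y, R ≤ ‖y‖ → V y = 0) ∧
      (∀ y, (∀ j, (1 : ℝ) / 2 < holeTerm k j y) → |levelFun k y - 1| < 3 * (1 / 200) →
        fderiv ℝ (levelFun k) y (V y) = 1) ∧
      (∀ (u : sphere (0 : EuclideanSpace ℝ (Fin 2)) 1) (t : ℝ), 1 - δ' < t → t < 1 + δ' →
        V (f₁ (t • (u : EuclideanSpace ℝ (Fin 2)))) =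
          (fderiv ℝ (fun y => levelFun k (f₁ y)) (t • (u : EuclideanSpace ℝ (Fin 2))) (u : EuclideanSpace ℝ (Fin 2)))⁻¹ •
            fderiv ℝ f₁ (t • (u : EuclideanSpace ℝ (Fin 2))) (u : EuclideanSpace ℝ (Fin 2))) := by
  -- A. the data: smoothness, the framed tube, the unit-clock field
  have hfs : ContDiff ℝ ∞ f₁ := contMDiff_iff_contDiff.1 hf.1
  have himm1 : ∀ x ∈ closedBall (0 : EuclideanSpace ℝ (Fin 2)) 1, Injective (fderiv ℝ f₁ x) := fun x hx => by
    have h := hf.2.2.1 x hx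
    rwa [mfderiv_eq_fderiv] at h
  obtain ⟨δ₁, η, F, Finv, hδ₁, hη, -, -, hF0, hFs, hFinj, hUo, hFinvs, hleft⟩ := exists_discTube hfs hf.2.1 himm1
  obtain ⟨W, hWs, hWsupp, hWclock⟩ := exists_levelField k (ε := 1 / 200) (by norm_num) le_rfl
  set dom : Set (EuclideanSpace ℝ (Fin 2) × EuclideanSpace ℝ (Fin 2)) :=
    ball (0 : EuclideanSpace ℝ (Fin 2)) (1 + δ₁) ×ˢ ball (0 : EuclideanSpace ℝ (Fin 2)) η with hdom
  have hdomo : IsOpen dom := isOpen_ball.prod isOpen_ball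
  set U : Set (EuclideanSpace ℝ (Fin 4)) := F '' dom with hU
  have hFat : ∀ q ∈ dom, ContDiffAt ℝ ∞ F q := fun q hq =>
    hFs.contDiffAt ((isOpen_ball.prod isOpen_univ).mem_nhds ⟨ball_subset_ball (by linarith) hq.1, mem_univ _⟩)
  have hFinvat : ∀ y ∈ U, ContDiffAt ℝ ∞ Finv y := fun y hy => hFinvs.contDiffAt (hUo.mem_nhds hy)
  have hright : ∀ y ∈ U, F (Finv y) = y := by
    rintro _ ⟨q, hq, rfl⟩; rw [hleft q hq]
  have hFinvmem : ∀ y ∈ U, Finv y ∈ dom := by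
    rintro _ ⟨q, hq, rfl⟩; rwa [hleft q hq]
  -- B. the smooth zone of `G_k` along the disc near the circle, where the radial clock is negative
  set Gf : EuclideanSpace ℝ (Fin 2) → ℝ := fun y => levelFun k (f₁ y) with hGf
  set A : Set (EuclideanSpace ℝ (Fin 2)) := {x | ∀ j : Fin k, (1 : ℝ) / 2 < holeTerm k j (f₁ x)} with hAdef
  have hA : IsOpen A := (isOpen_guard (r := k) (1 / 2)).preimage hfs.continuous
  have hGfA : ContDiffOn ℝ ∞ Gf A := fun x hx =>
    ((contDiffAt_levelFun fun j => (lt_trans (by norm_num) (hx j)).ne').comp x hfs.contDiffAt).contDiffWithinAt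
  have hsphA : ∀ x ∈ sphere (0 : EuclideanSpace ℝ (Fin 2)) 1, x ∈ A := by
    intro x hx j
    have h1 : f₁ x = K₁ ⟨x, hx⟩ := hf.apply_sphere ⟨x, hx⟩
    show (1 : ℝ) / 2 < holeTerm k j (f₁ x)
    rw [h1]
    exact lt_of_lt_of_le (by norm_num) ((hK.mem ⟨x, hx⟩).1 j)
  obtain ⟨δ₂, hδ₂, hδ₂δ₁, hδ₂1, hzone⟩ : ∃ δ₂ : ℝ, 0 < δ₂ ∧ δ₂ ≤ δ₁ ∧ δ₂ ≤ 1 / 2 ∧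
      ∀ x : EuclideanSpace ℝ (Fin 2), |‖x‖ - 1| < δ₂ → (∀ j, (1 : ℝ) / 2 < holeTerm k j (f₁ x)) ∧
        fderiv ℝ Gf x (‖x‖⁻¹ • x) < 0 := by
    set A' : Set (EuclideanSpace ℝ (Fin 2)) := (A ∩ {x | x ≠ 0}) ∩ (fun x => fderiv ℝ Gf x (‖x‖⁻¹ • x)) ⁻¹' Iio 0 with hA'
    have hA'o : IsOpen A' := by
      have hc : ContinuousOn (fun x => fderiv ℝ Gf x (‖x‖⁻¹ • x)) (A ∩ {x | x ≠ 0}) := by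
        intro x hx
        have h1 : ContinuousAt (fun x => fderiv ℝ Gf x) x :=
          ((hGfA.continuousOn_fderiv_of_isOpen hA (by simp)).continuousAt (hA.mem_nhds hx.1))
        have h2 : ContinuousAt (fun x : EuclideanSpace ℝ (Fin 2) => ‖x‖⁻¹ • x) x :=
          ((continuous_norm.continuousAt.inv₀ (norm_ne_zero_iff.2 hx.2)).smul continuousAt_id)
        exact (h1.clm_apply h2).continuousWithinAt
      exact hc.isOpen_inter_preimage (hA.inter (isOpen_ne.preimage continuous_id)) isOpen_Iio
    have hsub : sphere (0 : EuclideanSpace ℝ (Fin 2)) 1 ⊆ A' := by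
      intro x hx
      have hxA := hsphA x hx
      have hx1 : ‖x‖ = 1 := by simpa using hx
      have hx0 : x ≠ 0 := by intro h; rw [h, norm_zero] at hx1; exact zero_ne_one hx1
      refine ⟨⟨hxA, hx0⟩, ?_⟩
      show fderiv ℝ Gf x (‖x‖⁻¹ • x) < 0
      have hline : HasDerivAt (fun ρ : ℝ => ρ • x) x 1 := by simpa using (hasDerivAt_id (1 : ℝ)).smul_const x
      have hd : HasDerivAt (fun ρ : ℝ => Gf (ρ • x)) (fderiv ℝ Gf x x) 1 :=
        ((hGfA.contDiffAt (hA.mem_nhds hxA)).differentiableAt (by simp)).hasFDerivAt.comp_hasDerivAt_of_eq 1 hline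
          (by simp)
      rw [hx1, inv_one, one_smul, ← hd.deriv]
      exact hneat ⟨x, hx⟩
    obtain ⟨ε₀, hε₀, hth⟩ := (isCompact_sphere (0 : EuclideanSpace ℝ (Fin 2)) 1).exists_thickening_subset_open hA'o hsub
    refine ⟨min ε₀ (min δ₁ (1 / 2)), by positivity, (min_le_right _ _).trans (min_le_left _ _),
      (min_le_right _ _).trans (min_le_right _ _), fun x hx => ?_⟩
    have hε1 : min ε₀ (min δ₁ (1 / 2)) ≤ 1 := ((min_le_right _ _).trans (min_le_right _ _)).trans (by norm_num)
    have : thickening (min ε₀ (min δ₁ (1 / 2))) (sphere (0 : EuclideanSpace ℝ (Fin 2)) 1) ⊆ thickening ε₀ (sphere 0 1) :=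
      thickening_mono (min_le_left _ _) _
    obtain ⟨⟨hxA, -⟩, hneg⟩ := hth (this (mem_thickening_sphere hε1 hx))
    exact ⟨hxA, hneg⟩
  -- C. the disc field `X`, its clock `m`, on the tube
  set π₁ : EuclideanSpace ℝ (Fin 4) → EuclideanSpace ℝ (Fin 2) := fun y => (Finv y).1 with hπ₁
  set X : EuclideanSpace ℝ (Fin 4) → EuclideanSpace ℝ (Fin 4) :=
    fun y => fderiv ℝ f₁ (π₁ y) (‖π₁ y‖⁻¹ • π₁ y) with hX
  set m : EuclideanSpace ℝ (Fin 4) → ℝ := fun y => fderiv ℝ (levelFun k) y (X y) with hm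
  set VS : EuclideanSpace ℝ (Fin 4) → EuclideanSpace ℝ (Fin 4) := fun y => (m y)⁻¹ • X y with hVS
  have hzone1 : ∀ x : EuclideanSpace ℝ (Fin 2), |‖x‖ - 1| < δ₂ → ∀ j, (1 : ℝ) / 2 < holeTerm k j (f₁ x) :=
    fun x hx => (hzone x hx).1
  have hGon : ContDiffOn ℝ ∞ (levelFun k) {y : EuclideanSpace ℝ (Fin 4) | ∀ j : Fin k, (1 : ℝ) / 2 < holeTerm k j y} :=
    fun y hy => (contDiffAt_levelFun fun j => (lt_trans (by norm_num) (hy j)).ne').contDiffWithinAt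
  have hdG : ∀ y : EuclideanSpace ℝ (Fin 4), (∀ j, (1 : ℝ) / 2 < holeTerm k j y) →
      ContDiffAt ℝ ∞ (fun y => fderiv ℝ (levelFun k) y) y := fun y hy =>
    (hGon.fderiv_of_isOpen (isOpen_guard (1 / 2)) (by simp)).contDiffAt ((isOpen_guard (1 / 2)).mem_nhds hy)
  have hXat : ∀ y ∈ U, π₁ y ≠ 0 → ContDiffAt ℝ ∞ X y := by
    intro y hy h0
    have hπ : ContDiffAt ℝ ∞ π₁ y := contDiffAt_fst.comp y (hFinvat y hy)
    have h1 : ContDiffAt ℝ ∞ (fun y => fderiv ℝ f₁ (π₁ y)) y := (hfs.fderiv_right (m := ∞) (by simp)).contDiffAt.comp y hπ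
    have h2 : ContDiffAt ℝ ∞ (fun y => ‖π₁ y‖⁻¹ • π₁ y) y :=
      ((hπ.norm ℝ h0).inv (norm_ne_zero_iff.2 h0)).smul hπ
    exact h1.clm_apply h2
  have hmat : ∀ y ∈ U, π₁ y ≠ 0 → (∀ j, (1 : ℝ) / 2 < holeTerm k j y) → ContDiffAt ℝ ∞ m y :=
    fun y hy h0 hh => (hdG y hh).clm_apply (hXat y hy h0)
  have hVSat : ∀ y ∈ U, π₁ y ≠ 0 → (∀ j, (1 : ℝ) / 2 < holeTerm k j y) → m y ≠ 0 → ContDiffAt ℝ ∞ VS y :=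
    fun y hy h0 hh hm0 => ((hmat y hy h0 hh).inv hm0).smul (hXat y hy h0)
  -- D. on the disc near the circle: `π₁ (f₁ x) = x`, `m (f₁ x)` is the (negative) radial clock
  have hdisc : ∀ x : EuclideanSpace ℝ (Fin 2), |‖x‖ - 1| < δ₂ →
      f₁ x ∈ U ∧ Finv (f₁ x) = (x, 0) ∧ m (f₁ x) = fderiv ℝ Gf x (‖x‖⁻¹ • x) ∧ m (f₁ x) < 0 := by
    intro x hx
    have hxn : 1 - δ₂ < ‖x‖ ∧ ‖x‖ < 1 + δ₂ := by have := abs_lt.1 hx; constructor <;> linarith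
    have hq : ((x, (0 : EuclideanSpace ℝ (Fin 2))) : EuclideanSpace ℝ (Fin 2) × EuclideanSpace ℝ (Fin 2)) ∈ dom :=
      ⟨mem_ball_zero_iff.2 (by linarith), by simpa using hη⟩
    have hyU : f₁ x ∈ U := ⟨(x, 0), hq, hF0 x⟩
    have hFinv : Finv (f₁ x) = (x, 0) := by rw [← hF0 x]; exact hleft _ hq
    have hπx : π₁ (f₁ x) = x := by simp only [hπ₁, hFinv]
    have hGd : DifferentiableAt ℝ (levelFun k) (f₁ x) :=
      (contDiffAt_levelFun fun j => (lt_trans (by norm_num) ((hzone x hx).1 j)).ne').differentiableAt (by simp)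
    have hcomp : fderiv ℝ Gf x = (fderiv ℝ (levelFun k) (f₁ x)).comp (fderiv ℝ f₁ x) :=
      (hGd.hasFDerivAt.comp x ((hfs.differentiable (by simp)) x).hasFDerivAt).fderiv
    have hmx : m (f₁ x) = fderiv ℝ Gf x (‖x‖⁻¹ • x) := by
      simp only [hm, hX, hπx, hcomp, ContinuousLinearMap.comp_apply]
    exact ⟨hyU, hFinv, hmx, hmx ▸ (hzone x hx).2⟩
  -- E. the good set in tube coordinates and a compact block inside it
  set good : Set (EuclideanSpace ℝ (Fin 2) × EuclideanSpace ℝ (Fin 2)) :=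
    {q | q ∈ dom ∧ q.1 ≠ 0 ∧ (∀ j : Fin k, (1 : ℝ) / 2 < holeTerm k j (F q)) ∧ m (F q) < 0} with hgood
  have hgoodo : IsOpen good := by
    have h1 : IsOpen {q : EuclideanSpace ℝ (Fin 2) × EuclideanSpace ℝ (Fin 2) | q ∈ dom ∧ q.1 ≠ 0 ∧
        ∀ j : Fin k, (1 : ℝ) / 2 < holeTerm k j (F q)} := by
      have hc : ContinuousOn F dom := fun q hq => (hFat q hq).continuousAt.continuousWithinAt
      have h2 : IsOpen (dom ∩ F ⁻¹' {y : EuclideanSpace ℝ (Fin 4) | ∀ j : Fin k, (1 : ℝ) / 2 < holeTerm k j y}) :=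
        hc.isOpen_inter_preimage hdomo (isOpen_guard (1 / 2))
      have h3 : IsOpen {q : EuclideanSpace ℝ (Fin 2) × EuclideanSpace ℝ (Fin 2) | q.1 ≠ 0} :=
        isOpen_ne.preimage continuous_fst
      convert (h2.inter h3) using 1
      ext q; simp only [mem_setOf_eq, mem_inter_iff, mem_preimage]; tauto
    have hc : ContinuousOn (fun q => m (F q)) {q : EuclideanSpace ℝ (Fin 2) × EuclideanSpace ℝ (Fin 2) | q ∈ dom ∧ q.1 ≠ 0 ∧
        ∀ j : Fin k, (1 : ℝ) / 2 < holeTerm k j (F q)} := by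
      rintro q ⟨hq, hq0, hh⟩
      have hyU : F q ∈ U := ⟨q, hq, rfl⟩
      have hπ : π₁ (F q) = q.1 := by simp only [hπ₁, hleft q hq]
      exact ((hmat _ hyU (hπ ▸ hq0) hh).continuousAt.comp (hFat q hq).continuousAt).continuousWithinAt
    convert hc.isOpen_inter_preimage h1 isOpen_Iio using 1
    ext q; simp only [hgood, mem_setOf_eq, mem_inter_iff, mem_preimage, mem_Iio]; tauto
  set X₃ : Set (EuclideanSpace ℝ (Fin 2)) := {x | 1 - δ₂ / 2 ≤ ‖x‖ ∧ ‖x‖ ≤ 1 + δ₂ / 2} with hX₃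
  have hX₃c : IsCompact X₃ := by
    have : X₃ = closedBall (0 : EuclideanSpace ℝ (Fin 2)) (1 + δ₂ / 2) ∩ {x | 1 - δ₂ / 2 ≤ ‖x‖} := by
      ext x; simp only [hX₃, mem_setOf_eq, mem_inter_iff, mem_closedBall, dist_zero_right]; tauto
    rw [this]
    exact (isCompact_closedBall _ _).inter_right (isClosed_le continuous_const continuous_norm)
  have hX₃good : X₃ ×ˢ ({0} : Set (EuclideanSpace ℝ (Fin 2))) ⊆ good := by
    rintro ⟨x, w⟩ ⟨hx, hw⟩
    rw [mem_singleton_iff] at hw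
    subst hw
    have hx' : |‖x‖ - 1| < δ₂ := by rw [abs_lt]; obtain ⟨h1, h2⟩ := hx; constructor <;> linarith
    obtain ⟨-, hFinv, -, hmneg⟩ := hdisc x hx'
    have hx0 : x ≠ 0 := by
      intro h; obtain ⟨h1, -⟩ := hx; rw [h, norm_zero] at h1; linarith
    refine ⟨⟨mem_ball_zero_iff.2 (by linarith [hx.2]), by simpa using hη⟩, hx0, ?_, ?_⟩
    · rw [hF0]; exact hzone1 x hx'
    · rw [hF0]; exact hmneg
  obtain ⟨θ, hθ, hthick⟩ := (hX₃c.prod isCompact_singleton).exists_thickening_subset_open hgoodo hX₃good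
  set η₃ : ℝ := min θ η / 2 with hη₃
  have hη₃pos : 0 < η₃ := by rw [hη₃]; have := lt_min hθ hη; linarith
  have hη₃θ : η₃ < θ := by rw [hη₃]; have := min_le_left θ η; linarith
  have hη₃η : η₃ < η := by rw [hη₃]; have := min_le_right θ η; linarith
  set K : Set (EuclideanSpace ℝ (Fin 2) × EuclideanSpace ℝ (Fin 2)) := X₃ ×ˢ closedBall (0 : EuclideanSpace ℝ (Fin 2)) η₃ with hKdef
  have hKc : IsCompact K := hX₃c.prod (isCompact_closedBall _ _)
  have hKgood : K ⊆ good := by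
    rintro ⟨x, w⟩ ⟨hx, hw⟩
    refine hthick (Metric.mem_thickening_iff.2 ⟨(x, 0), ⟨hx, rfl⟩, ?_⟩)
    rw [Prod.dist_eq, dist_self, dist_zero_right]
    exact max_lt_iff.2 ⟨hθ, lt_of_le_of_lt (mem_closedBall_zero_iff.1 hw) hη₃θ⟩
  have hgooddom : good ⊆ dom := fun q hq => hq.1
  set C : Set (EuclideanSpace ℝ (Fin 4)) := F '' K with hCdef
  have hCc : IsCompact C := hKc.image_of_continuousOn fun q hq => (hFat q (hgooddom (hKgood hq))).continuousAt.continuousWithinAt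
  -- the open set over the good set, containing `C`
  set U₁ : Set (EuclideanSpace ℝ (Fin 4)) := U ∩ Finv ⁻¹' good with hU₁
  have hU₁o : IsOpen U₁ := hFinvs.continuousOn.isOpen_inter_preimage hUo hgoodo
  have hCU₁ : C ⊆ U₁ := by
    rintro _ ⟨q, hq, rfl⟩
    exact ⟨⟨q, hgooddom (hKgood hq), rfl⟩, by rw [mem_preimage, hleft q (hgooddom (hKgood hq))]; exact hKgood hq⟩
  have hU₁prop : ∀ y ∈ U₁, y ∈ U ∧ π₁ y ≠ 0 ∧ (∀ j, (1 : ℝ) / 2 < holeTerm k j y) ∧ m y < 0 := by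
    rintro y ⟨hyU, hg⟩
    obtain ⟨-, h0, hh, hmy⟩ := hg
    rw [hright y hyU] at hh hmy
    exact ⟨hyU, h0, hh, hmy⟩
  -- F. the cutoff
  obtain ⟨hφ₁s, hφ₁one, hφ₁supp, hφ₁01⟩ := plateau_props ((1 - δ₂ / 2) ^ 2) ((1 + δ₂ / 2) ^ 2) (δ₂ / 4) (by positivity)
  obtain ⟨hφ₂s, hφ₂one, hφ₂supp, hφ₂01⟩ := plateau_props (-(η₃ ^ 2)) (η₃ ^ 2) (η₃ ^ 2 / 2) (by positivity)
  classical
  set β : EuclideanSpace ℝ (Fin 4) → ℝ := fun y => if y ∈ U then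
    (Real.smoothTransition ((‖(Finv y).1‖ ^ 2 - (1 - δ₂ / 2) ^ 2) / (δ₂ / 4)) *
      Real.smoothTransition (((1 + δ₂ / 2) ^ 2 - ‖(Finv y).1‖ ^ 2) / (δ₂ / 4))) *
    (Real.smoothTransition ((‖(Finv y).2‖ ^ 2 - (-(η₃ ^ 2))) / (η₃ ^ 2 / 2)) *
      Real.smoothTransition ((η₃ ^ 2 - ‖(Finv y).2‖ ^ 2) / (η₃ ^ 2 / 2))) else 0 with hβ
  have hβU : ∀ y ∈ U, β y = (Real.smoothTransition ((‖(Finv y).1‖ ^ 2 - (1 - δ₂ / 2) ^ 2) / (δ₂ / 4)) *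
      Real.smoothTransition (((1 + δ₂ / 2) ^ 2 - ‖(Finv y).1‖ ^ 2) / (δ₂ / 4))) *
    (Real.smoothTransition ((‖(Finv y).2‖ ^ 2 - (-(η₃ ^ 2))) / (η₃ ^ 2 / 2)) *
      Real.smoothTransition ((η₃ ^ 2 - ‖(Finv y).2‖ ^ 2) / (η₃ ^ 2 / 2))) := fun y hy => by
    simp only [hβ, if_pos hy]
  have hβ01 : ∀ y, 0 ≤ β y ∧ β y ≤ 1 := by
    intro y
    by_cases hy : y ∈ U
    · rw [hβU y hy]
      exact ⟨mul_nonneg (hφ₁01 _).1 (hφ₂01 _).1, mul_le_one₀ (hφ₁01 _).2 (hφ₂01 _).1 (hφ₂01 _).2⟩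
    · simp only [hβ, if_neg hy]; exact ⟨le_rfl, zero_le_one⟩
  -- where `β ≠ 0` the point lies in `C`
  have hβC : ∀ y, β y ≠ 0 → y ∈ C := by
    intro y h
    by_cases hy : y ∈ U
    · rw [hβU y hy] at h
      obtain ⟨h1, h2⟩ := mul_ne_zero_iff.1 h
      obtain ⟨ha, hb⟩ := hφ₁supp _ h1
      obtain ⟨-, hd⟩ := hφ₂supp _ h2
      have hq := hFinvmem y hy
      refine ⟨Finv y, ⟨⟨?_, ?_⟩, ?_⟩, hright y hy⟩
      · nlinarith [norm_nonneg (Finv y).1, sq_nonneg (‖(Finv y).1‖ - (1 - δ₂ / 2))]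
      · nlinarith [norm_nonneg (Finv y).1, sq_nonneg (‖(Finv y).1‖ + (1 + δ₂ / 2))]
      · rw [mem_closedBall_zero_iff]
        nlinarith [norm_nonneg (Finv y).2, sq_nonneg (‖(Finv y).2‖ + η₃)]
    · simp only [hβ, if_neg hy] at h; exact absurd rfl h
  have hβs : ContDiff ℝ ∞ β := by
    rw [contDiff_iff_contDiffAt]
    intro y
    by_cases hy : y ∈ U
    · have hev : β =ᶠ[𝓝 y] fun y => (Real.smoothTransition ((‖(Finv y).1‖ ^ 2 - (1 - δ₂ / 2) ^ 2) / (δ₂ / 4)) *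
          Real.smoothTransition (((1 + δ₂ / 2) ^ 2 - ‖(Finv y).1‖ ^ 2) / (δ₂ / 4))) *
        (Real.smoothTransition ((‖(Finv y).2‖ ^ 2 - (-(η₃ ^ 2))) / (η₃ ^ 2 / 2)) *
          Real.smoothTransition ((η₃ ^ 2 - ‖(Finv y).2‖ ^ 2) / (η₃ ^ 2 / 2))) := by
        filter_upwards [hUo.mem_nhds hy] with y' hy'
        exact hβU y' hy'
      refine ContDiffAt.congr_of_eventuallyEq ?_ hev
      have hFi := hFinvat y hy
      exact (hφ₁s.contDiffAt.comp y ((contDiffAt_fst.comp y hFi).norm_sq ℝ)).mul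
        (hφ₂s.contDiffAt.comp y ((contDiffAt_snd.comp y hFi).norm_sq ℝ))
    · have hyC : y ∉ C := fun h => hy (hCU₁ h).1
      have hev : β =ᶠ[𝓝 y] fun _ => 0 := by
        filter_upwards [hCc.isClosed.isOpen_compl.mem_nhds hyC] with y' hy'
        by_contra h
        exact hy' (hβC y' h)
      exact (contDiffAt_const (c := (0 : ℝ))).congr_of_eventuallyEq hev
  -- G. the field
  set V : EuclideanSpace ℝ (Fin 4) → EuclideanSpace ℝ (Fin 4) := fun y => β y • VS y + (1 - β y) • W y with hV
  have hVs : ContDiff ℝ ∞ V := by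
    rw [contDiff_iff_contDiffAt]
    intro y
    by_cases hy : y ∈ U₁
    · obtain ⟨hyU, h0, hh, hmy⟩ := hU₁prop y hy
      have h1 := hVSat y hyU h0 hh hmy.ne
      simp only [hV]
      exact (hβs.contDiffAt.smul h1).add ((contDiffAt_const.sub hβs.contDiffAt).smul hWs.contDiffAt)
    · have hyC : y ∉ C := fun h => hy (hCU₁ h)
      have hev : V =ᶠ[𝓝 y] W := by
        filter_upwards [hCc.isClosed.isOpen_compl.mem_nhds hyC] with y' hy'
        have hβ0 : β y' = 0 := by by_contra h; exact hy' (hβC y' h)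
        simp only [hV, hβ0, zero_smul, sub_zero, one_smul, zero_add]
      exact hWs.contDiffAt.congr_of_eventuallyEq hev
  -- H. support
  obtain ⟨B, hB⟩ := hCc.isBounded.exists_norm_le
  refine ⟨V, max (2 * (40 * ((k : ℝ) + 1))) B + 1, δ₂ / 4, hVs, by positivity, fun y hy => ?_, fun y hh hG => ?_, fun u t ht1 ht2 => ?_⟩
  · have hW0 : W y = 0 := hWsupp y (by linarith [le_max_left (2 * (40 * ((k : ℝ) + 1))) B])
    have hβ0 : β y = 0 := by
      by_contra h
      have := hB y (hβC y h)
      linarith [le_max_right (2 * (40 * ((k : ℝ) + 1))) B]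
    simp only [hV, hW0, hβ0, zero_smul, smul_zero, add_zero]
  · -- I. the clock identity
    have hW1 := hWclock y hh hG
    by_cases hβ0 : β y = 0
    · simp only [hV, hβ0, zero_smul, sub_zero, one_smul, zero_add, hW1]
    · obtain ⟨hyU, h0, -, hmy⟩ := hU₁prop y (hCU₁ (hβC y hβ0))
      have hm0 : m y ≠ 0 := hmy.ne
      have hS1 : fderiv ℝ (levelFun k) y (VS y) = 1 := by
        simp only [hVS, map_smul, smul_eq_mul]
        show (m y)⁻¹ * m y = 1
        exact inv_mul_cancel₀ hm0
      simp only [hV, map_add, map_smul, hS1, hW1, smul_eq_mul]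
      ring
  · -- J. tangency along the disc
    set x : EuclideanSpace ℝ (Fin 2) := t • (u : EuclideanSpace ℝ (Fin 2)) with hxdef
    have ht0 : 0 < t := by linarith
    have hxn : ‖x‖ = t := by
      rw [hxdef, norm_smul, norm_eq_of_mem_sphere, mul_one, Real.norm_eq_abs, abs_of_pos ht0]
    have hx' : |‖x‖ - 1| < δ₂ := by rw [hxn, abs_lt]; constructor <;> linarith
    obtain ⟨hyU, hFinv, hm1, -⟩ := hdisc x hx'
    have hβ1 : β (f₁ x) = 1 := by
      obtain ⟨c1, c2⟩ := sq_window (t := ‖x‖) hδ₂ hδ₂1 (by rw [hxn]; linarith) (by rw [hxn]; linarith)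
      obtain ⟨c3, c4⟩ := fibre_window η₃
      rw [hβU _ hyU, hFinv]
      dsimp only
      rw [norm_zero, hφ₁one _ c1 c2, hφ₂one _ c3 c4, one_mul]
    have hπx : π₁ (f₁ x) = x := by simp only [hπ₁, hFinv]
    have hux : ‖x‖⁻¹ • x = (u : EuclideanSpace ℝ (Fin 2)) := by
      rw [hxn, hxdef, smul_smul, inv_mul_cancel₀ ht0.ne', one_smul]
    simp only [hV, hβ1, one_smul, sub_self, zero_smul, add_zero, hVS, hm1, hX, hπx, hux, hGf]

end FriendsCarrierVk

open FriendsCarrierVk in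
/-- **Helper `helper_friendsCarrier_Vk_adaptedFieldNeat`** (registered piece of `helper_friendsCarrier_Vk`: the
unit-clock field adapted to a NEAT model slice disc).  For a model slice disc `f₁` of a model knot
`K₁` leaving `D_k` transversally along `K₁` (`d/dρ G_k(f₁(ρ t))|₁ < 0`), there are a `C^∞` field `V`
on `ℝ⁴` vanishing outside a ball, with `dG_k(V) = 1` on the clock zone
`{∀ j, |z - c_j|² > 1/2} ∩ {|G_k - 1| < 3/200}`, and `δ' > 0` with
`V(f₁(t u)) = (d(G_k ∘ f₁)(t u) u)⁻¹ • df₁(t u) u` for `|t - 1| < δ'`: the field is tangent to the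
disc rays, clocked by the level. [cite: Milnor1963, Thm. 3.1] -/
theorem helper_friendsCarrier_Vk_adaptedFieldNeat : ∀ (k : ℕ) (K₁ : (Metric.sphere (0 : EuclideanSpace ℝ (Fin 2)) 1) → EuclideanSpace ℝ (Fin 4)) (f₁ : EuclideanSpace ℝ (Fin 2) → EuclideanSpace ℝ (Fin 4)), Literature.Topology.FourManifolds.MMSW.IsModelKnot k K₁ → Literature.Topology.FourManifolds.MMSW.IsModelSliceDisc k K₁ f₁ → (∀ t : (Metric.sphere (0 : EuclideanSpace ℝ (Fin 2)) 1), deriv (fun ρ : ℝ => Literature.Topology.FourManifolds.MMSW.levelFun k (f₁ (ρ • (t : EuclideanSpace ℝ (Fin 2))))) 1 < 0) → ∃ (V : EuclideanSpace ℝ (Fin 4) → EuclideanSpace ℝ (Fin 4)) (R δ' : ℝ), ContDiff ℝ ((⊤ : ℕ∞) : WithTop ℕ∞) V ∧ 0 < δ' ∧ (∀ y, R ≤ ‖y‖ → V y = 0) ∧ (∀ y, (∀ j, (1 : ℝ) / 2 < Literature.Topology.FourManifolds.MMSW.holeTerm k j y) → |Literature.Topology.FourManifolds.MMSW.levelFun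 k y - 1| < 3 * (1 / 200) → fderiv ℝ (Literature.Topology.FourManifolds.MMSW.levelFun k) y (V y) = 1) ∧ (∀ (u : (Metric.sphere (0 : EuclideanSpace ℝ (Fin 2)) 1)) (t : ℝ), 1 - δ' < t → t < 1 + δ' → V (f₁ (t • (u : EuclideanSpace ℝ (Fin 2)))) = (fderiv ℝ (fun y => Literature.Topology.FourManifolds.MMSW.levelFun k (f₁ y)) (t • (u : EuclideanSpace ℝ (Fin 2))) (u : EuclideanSpace ℝ (Fin 2)))⁻¹ • fderiv ℝ f₁ (t • (u : EuclideanSpace ℝ (Fin 2))) (u : EuclideanSpace ℝ (Fin 2))) :=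
  fun k _ _ hK hf hneat => exists_adaptedFieldNeat k hK hf hneat

end Summit.SmoothPoincare4.SmoothPoincare4.Theorems.DcrGap.MkFriends

end
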